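import Summits.NavierStokesRegularity.NavierStokesRegularity.Theorems.OddMorawetzMorawetzKillsTypeIKitSums
import Summits.NavierStokesRegularity.NavierStokesRegularity.Theorems.OddMorawetzMorawetzKillsTypeIKitSign
import Summits.NavierStokesRegularity.NavierStokesRegularity.Theorems.OddMorawetzMorawetzKillsTypeIKitPerm
import Summits.NavierStokesRegularity.NavierStokesRegularity.Theorems.OddMorawetzMorawetzKillsTypeISymBasis
import Summits.NavierStokesRegularity.NavierStokesRegularity.Theorems.OddMorawetzMorawetzKillsTypeIInfinitesimalInvariance
import Summits.NavierStokesRegularity.NavierStokesRegularity.Theorems.OddMorawetzMorawetzKillsTypeIWeightParity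
import Literature.Analysis.Calculus.IteratedFDerivSymmetric
import Summits.NavierStokesRegularity.NavierStokesRegularity.Theorems.OddMorawetzMorawetzKillsTypeIJetCoordDefs

/-!
# Crux `MorawetzKillsTypeI` — structure of invariant weight-3 densities: the common frame

Shared set-up for the three block computations (u u T), (u A H), (A A A) of `stub_isoStructureThree`: for a smooth,
pointwise cubic, derivative-weight-3, isometry-invariant density `m` on 3-jets and `T := D³m(0)`,
`6 m z = T(z,z,z) = 3 T(z_u,z_u,z_T) + 6 T(z_u,z_A,z_H) + T(z_A,z_A,z_A)` (`six_m_eq_blocks`), `T` is symmetric and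
isometry invariant, and the pure parts of a SYMMETRIC jet expand in the symmetrised bases `jbsum`
(`zU_expand`, `zA_expand`, `zH_expand`, `zT_expand`). Everything is proved; no definitions.
-/

noncomputable section

open scoped BigOperators

set_option linter.dupNamespace false

namespace Summit.NavierStokesRegularity.NavierStokesRegularity.Theorems

open Summit.NavierStokesRegularity.NavierStokesRegularity.Theorems.OddMorawetz

namespace IsoStructureThree

variable {m : Jet3 → ℝ}

/-- `T = D³m(0)` is symmetric. -/
theorem T_symm (hm : ContDiff ℝ (⊤ : ℕ∞) m) (x : Fin 3 → Jet3) (σ : Equiv.Perm (Fin 3)) :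
    iteratedFDeriv ℝ 3 m 0 (x ∘ σ) = iteratedFDeriv ℝ 3 m 0 x :=
  Literature.Analysis.Calculus.iteratedFDeriv_comp_perm_of_contDiff (𝕜 := ℝ) hm (ENat.natCast_le_of_coe_top_le_withTop le_rfl 3) 0 x σ

/-- `6 m z = T(z, z, z)`. -/
theorem six_m (hm : ContDiff ℝ (⊤ : ℕ∞) m) (hcub : ∀ (μ : ℝ) (z : Jet3), m (μ • z) = μ ^ 3 * m z) (z : Jet3) :
    6 * m z = iteratedFDeriv ℝ 3 m 0 (fun _ => z) :=
  six_mul_eq_iteratedFDeriv_of_cubic hm hcub z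

/-- The diagonal weight identity of `T`. -/
theorem T_weight (hm : ContDiff ℝ (⊤ : ℕ∞) m) (hcub : ∀ (μ : ℝ) (z : Jet3), m (μ • z) = μ ^ 3 * m z)
    (hwt : ∀ (s : ℝ), 0 < s → ∀ (z₀ : E3) (z₁ : E3 [×1]→L[ℝ] E3) (z₂ : E3 [×2]→L[ℝ] E3) (z₃ : E3 [×3]→L[ℝ] E3),
      m (z₀, s • z₁, (s ^ 2) • z₂, (s ^ 3) • z₃) = s ^ 3 * m (z₀, z₁, z₂, z₃))
    (s : ℝ) (hs : 0 < s) (z : Jet3) :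
    iteratedFDeriv ℝ 3 m 0 (fun _ => ((z.1, s • z.2.1, (s ^ 2) • z.2.2.1, (s ^ 3) • z.2.2.2) : Jet3)) =
      s ^ 3 * iteratedFDeriv ℝ 3 m 0 (fun _ => z) := by
  rw [← six_m hm hcub, ← six_m hm hcub]
  rcases z with ⟨z0, z1, z2, z3⟩
  rw [hwt s hs z0 z1 z2 z3]
  ring

/-- **The weight-3 block decomposition**: `6 m z = 3 T(z_u,z_u,z_T) + 6 T(z_u,z_A,z_H) + T(z_A,z_A,z_A)`. -/
theorem six_m_eq_blocks (hm : ContDiff ℝ (⊤ : ℕ∞) m) (hcub : ∀ (μ : ℝ) (z : Jet3), m (μ • z) = μ ^ 3 * m z)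
    (hwt : ∀ (s : ℝ), 0 < s → ∀ (z₀ : E3) (z₁ : E3 [×1]→L[ℝ] E3) (z₂ : E3 [×2]→L[ℝ] E3) (z₃ : E3 [×3]→L[ℝ] E3),
      m (z₀, s • z₁, (s ^ 2) • z₂, (s ^ 3) • z₃) = s ^ 3 * m (z₀, z₁, z₂, z₃))
    (z : Jet3) :
    6 * m z =
      3 * iteratedFDeriv ℝ 3 m 0 ![((z.1, 0, 0, 0) : Jet3), ((z.1, 0, 0, 0) : Jet3), ((0, 0, 0, z.2.2.2) : Jet3)] +
      6 * iteratedFDeriv ℝ 3 m 0 ![((z.1, 0, 0, 0) : Jet3), ((0, z.2.1, 0, 0) : Jet3), ((0, 0, z.2.2.1, 0) : Jet3)] +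
      iteratedFDeriv ℝ 3 m 0 ![((0, z.2.1, 0, 0) : Jet3), ((0, z.2.1, 0, 0) : Jet3), ((0, z.2.1, 0, 0) : Jet3)] := by
  rw [six_m hm hcub]
  exact ((stub_cubicJetExpansion).2 3 (iteratedFDeriv ℝ 3 m 0) (T_symm hm) (T_weight hm hcub hwt)).1 rfl z

/-- `T` is invariant under the jet action of every linear isometry. -/
theorem T_inv (hm : ContDiff ℝ (⊤ : ℕ∞) m) (hinv : ∀ (g : E3 ≃ₗᵢ[ℝ] E3) (z : Jet3), m (jetAct g z) = m z)
    (g : E3 ≃ₗᵢ[ℝ] E3) (x : Fin 3 → Jet3) :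
    iteratedFDeriv ℝ 3 m 0 (fun s => jetAct g (x s)) = iteratedFDeriv ℝ 3 m 0 x :=
  iteratedFDeriv_three_zero_jetAct hm hinv g x

/-! ### Expansions of the pure parts of a jet in the symmetrised bases -/

/-- `(z₀, 0, 0, 0) = ∑ₐ (z₀)ₐ • (eₐ, 0, 0, 0)`. -/
theorem zU_expand (z : Jet3) :
    ((z.1, 0, 0, 0) : Jet3) = ∑ a : Fin 3, (z.1 a) • ((EuclideanSpace.single a (1 : ℝ), 0, 0, 0) : Jet3) := by
  rw [← (KitSums.embed_sum Finset.univ (fun a => z.1 a)).1]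
  congr 1
  exact SymBasis.eq_sum_single z.1

/-- `(0, z₁, 0, 0) = ∑_c ∑_J (z₁ (e ∘ J))_c • (0, jbsum 1 c J, 0, 0)`. -/
theorem zA_expand (z : Jet3) :
    ((0, z.2.1, 0, 0) : Jet3) = ∑ c : Fin 3, ∑ J : Fin 1 → Fin 3,
      (z.2.1 (fun s => EuclideanSpace.single (J s) (1 : ℝ)) c) • ((0, jbsum 1 c J, 0, 0) : Jet3) := by
  have h := SymBasis.symm_expansion 1 z.2.1 (fun h σ => by rw [Subsingleton.elim σ 1]; rfl)
  simp only [Nat.factorial_one, Nat.cast_one, div_one] at h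
  conv_lhs => rw [h]
  rw [← Finset.sum_product', ← Finset.sum_product']
  · exact ((KitSums.embed_sum (Finset.univ ×ˢ Finset.univ) (fun p : Fin 3 × (Fin 1 → Fin 3) => z.2.1 (fun s => EuclideanSpace.single (p.2 s) (1 : ℝ)) p.1)).2.1
      (fun p => jbsum 1 p.1 p.2))

/-- `(0, 0, z₂, 0) = ∑_c ∑_J ((z₂ (e ∘ J))_c / 2) • (0, 0, jbsum 2 c J, 0)` for symmetric `z₂`. -/
theorem zH_expand (z : Jet3) (hz2 : ∀ (h : Fin 2 → E3) (σ : Equiv.Perm (Fin 2)), z.2.2.1 (h ∘ σ) = z.2.2.1 h) :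
    ((0, 0, z.2.2.1, 0) : Jet3) = ∑ c : Fin 3, ∑ J : Fin 2 → Fin 3,
      (z.2.2.1 (fun s => EuclideanSpace.single (J s) (1 : ℝ)) c / 2) • ((0, 0, jbsum 2 c J, 0) : Jet3) := by
  have h := SymBasis.symm_expansion 2 z.2.2.1 hz2
  simp only [Nat.factorial_two, Nat.cast_ofNat] at h
  conv_lhs => rw [h]
  rw [← Finset.sum_product', ← Finset.sum_product']
  exact ((KitSums.embed_sum (Finset.univ ×ˢ Finset.univ)
    (fun p : Fin 3 × (Fin 2 → Fin 3) => z.2.2.1 (fun s => EuclideanSpace.single (p.2 s) (1 : ℝ)) p.1 / 2)).2.2.1 (fun p => jbsum 2 p.1 p.2))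

/-- `(0, 0, 0, z₃) = ∑_c ∑_J ((z₃ (e ∘ J))_c / 6) • (0, 0, 0, jbsum 3 c J)` for symmetric `z₃`. -/
theorem zT_expand (z : Jet3) (hz3 : ∀ (h : Fin 3 → E3) (σ : Equiv.Perm (Fin 3)), z.2.2.2 (h ∘ σ) = z.2.2.2 h) :
    ((0, 0, 0, z.2.2.2) : Jet3) = ∑ c : Fin 3, ∑ J : Fin 3 → Fin 3,
      (z.2.2.2 (fun s => EuclideanSpace.single (J s) (1 : ℝ)) c / 6) • ((0, 0, 0, jbsum 3 c J) : Jet3) := by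
  have h := SymBasis.symm_expansion 3 z.2.2.2 hz3
  have h6 : ((3 : ℕ).factorial : ℝ) = 6 := by norm_num [Nat.factorial]
  rw [h6] at h
  conv_lhs => rw [h]
  rw [← Finset.sum_product', ← Finset.sum_product']
  exact ((KitSums.embed_sum (Finset.univ ×ˢ Finset.univ)
    (fun p : Fin 3 × (Fin 3 → Fin 3) => z.2.2.2 (fun s => EuclideanSpace.single (p.2 s) (1 : ℝ)) p.1 / 6)).2.2.2 (fun p => jbsum 3 p.1 p.2))


/-! ### Derivation formulas with explicit index tuples; embedding of a vector; signed linearity -/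

/-- `update ![j₀] 0 j' = ![j']`. -/
theorem update_vec1 (j₀ j' : Fin 3) : Function.update ![j₀] 0 j' = ![j'] := by
  funext s; fin_cases s; rfl

/-- `update ![j₀, j₁] 0 j' = ![j', j₁]`. -/
theorem update_vec2_zero (j₀ j₁ j' : Fin 3) : Function.update ![j₀, j₁] 0 j' = ![j', j₁] := by
  funext s; fin_cases s <;> rfl

/-- `update ![j₀, j₁] 1 j' = ![j₀, j']`. -/
theorem update_vec2_one (j₀ j₁ j' : Fin 3) : Function.update ![j₀, j₁] 1 j' = ![j₀, j'] := by
  funext s; fin_cases s <;> rfl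

/-- `update ![j₀, j₁, j₂] 0 j' = ![j', j₁, j₂]`. -/
theorem update_vec3_zero (j₀ j₁ j₂ j' : Fin 3) : Function.update ![j₀, j₁, j₂] 0 j' = ![j', j₁, j₂] := by
  funext s; fin_cases s <;> rfl

/-- `update ![j₀, j₁, j₂] 1 j' = ![j₀, j', j₂]`. -/
theorem update_vec3_one (j₀ j₁ j₂ j' : Fin 3) : Function.update ![j₀, j₁, j₂] 1 j' = ![j₀, j', j₂] := by
  funext s; fin_cases s <;> rfl

/-- `update ![j₀, j₁, j₂] 2 j' = ![j₀, j₁, j']`. -/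
theorem update_vec3_two (j₀ j₁ j₂ j' : Fin 3) : Function.update ![j₀, j₁, j₂] 2 j' = ![j₀, j₁, j'] := by
  funext s; fin_cases s <;> rfl

/-- The derivation formula on `jbsum 1 c ![j₀]`, indices explicit. -/
theorem derivation_one (L : E3 →L[ℝ] E3) (c j₀ : Fin 3) :
    L.compContinuousMultilinearMap (jbsum 1 c ![j₀]) -
        ∑ s : Fin 1, (jbsum 1 c ![j₀]).compContinuousLinearMap
          (Function.update (fun _ => ContinuousLinearMap.id ℝ E3) s L) =
      ∑ c' : Fin 3, (L (EuclideanSpace.single c (1 : ℝ)) c') • jbsum 1 c' ![j₀] -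
        ∑ j' : Fin 3, (L (EuclideanSpace.single j' (1 : ℝ)) j₀) • jbsum 1 c ![j'] := by
  rw [SymBasis.derivation_jbsum]
  simp only [Fin.sum_univ_one, Fin.isValue, Matrix.cons_val_zero, update_vec1]

/-- The derivation formula on `jbsum 2 c ![j₀, j₁]`, indices explicit. -/
theorem derivation_two (L : E3 →L[ℝ] E3) (c j₀ j₁ : Fin 3) :
    L.compContinuousMultilinearMap (jbsum 2 c ![j₀, j₁]) -
        ∑ s : Fin 2, (jbsum 2 c ![j₀, j₁]).compContinuousLinearMap
          (Function.update (fun _ => ContinuousLinearMap.id ℝ E3) s L) =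
      ∑ c' : Fin 3, (L (EuclideanSpace.single c (1 : ℝ)) c') • jbsum 2 c' ![j₀, j₁] -
        ∑ j' : Fin 3, (L (EuclideanSpace.single j' (1 : ℝ)) j₀) • jbsum 2 c ![j', j₁] -
        ∑ j' : Fin 3, (L (EuclideanSpace.single j' (1 : ℝ)) j₁) • jbsum 2 c ![j₀, j'] := by
  rw [SymBasis.derivation_jbsum]
  simp only [Fin.sum_univ_two, Fin.isValue, Matrix.cons_val_zero, Matrix.cons_val_one,
    update_vec2_zero, update_vec2_one]
  abel

/-- The derivation formula on `jbsum 3 c ![j₀, j₁, j₂]`, indices explicit. -/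
theorem derivation_three (L : E3 →L[ℝ] E3) (c j₀ j₁ j₂ : Fin 3) :
    L.compContinuousMultilinearMap (jbsum 3 c ![j₀, j₁, j₂]) -
        ∑ s : Fin 3, (jbsum 3 c ![j₀, j₁, j₂]).compContinuousLinearMap
          (Function.update (fun _ => ContinuousLinearMap.id ℝ E3) s L) =
      ∑ c' : Fin 3, (L (EuclideanSpace.single c (1 : ℝ)) c') • jbsum 3 c' ![j₀, j₁, j₂] -
        ∑ j' : Fin 3, (L (EuclideanSpace.single j' (1 : ℝ)) j₀) • jbsum 3 c ![j', j₁, j₂] -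
        ∑ j' : Fin 3, (L (EuclideanSpace.single j' (1 : ℝ)) j₁) • jbsum 3 c ![j₀, j', j₂] -
        ∑ j' : Fin 3, (L (EuclideanSpace.single j' (1 : ℝ)) j₂) • jbsum 3 c ![j₀, j₁, j'] := by
  rw [SymBasis.derivation_jbsum]
  simp only [Fin.sum_univ_three, Fin.isValue, Matrix.cons_val_zero, Matrix.cons_val_one, Matrix.head_cons,
    Matrix.cons_val_two, Matrix.tail_cons, update_vec3_zero, update_vec3_one, update_vec3_two]
  abel

/-- `(x, 0, 0, 0) = ∑_b x_b • (e_b, 0, 0, 0)`. -/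
theorem U_expand (x : E3) :
    ((x, 0, 0, 0) : Jet3) = ∑ b : Fin 3, (x b) • ((EuclideanSpace.single b (1 : ℝ), 0, 0, 0) : Jet3) := by
  rw [← (KitSums.embed_sum Finset.univ (fun b => x b)).1]
  congr 1
  exact SymBasis.eq_sum_single x

variable {T : Jet3 [×3]→L[ℝ] ℝ}

/-- Subtraction in the first slot. -/
theorem tri_sub₁ (x x' y w : Jet3) : T ![x - x', y, w] = T ![x, y, w] - T ![x', y, w] := by
  rw [sub_eq_add_neg, CubicJetExpansion.tri_add₁, neg_one_smul ℝ x' |>.symm, CubicJetExpansion.tri_smul₁]; ring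

/-- Subtraction in the second slot (symmetric `T`). -/
theorem tri_sub₂ (hTsym : ∀ (x : Fin 3 → Jet3) (σ : Equiv.Perm (Fin 3)), T (x ∘ σ) = T x) (x y y' w : Jet3) :
    T ![x, y - y', w] = T ![x, y, w] - T ![x, y', w] := by
  rw [CubicJetExpansion.tri_swap₁₂ hTsym x (y - y') w, tri_sub₁, CubicJetExpansion.tri_swap₁₂ hTsym y,
    CubicJetExpansion.tri_swap₁₂ hTsym y']

/-- Subtraction in the third slot (symmetric `T`). -/
theorem tri_sub₃ (hTsym : ∀ (x : Fin 3 → Jet3) (σ : Equiv.Perm (Fin 3)), T (x ∘ σ) = T x) (x y w w' : Jet3) :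
    T ![x, y, w - w'] = T ![x, y, w] - T ![x, y, w'] := by
  rw [CubicJetExpansion.tri_swap₁₃ hTsym x y (w - w'), tri_sub₁, CubicJetExpansion.tri_swap₁₃ hTsym w,
    CubicJetExpansion.tri_swap₁₃ hTsym w']

/-- Linearity of the pure embeddings through subtraction and sums (the forms produced by the derivation formulas). -/
theorem embed_sub :
    (∀ (X Y : E3 [×1]→L[ℝ] E3), ((0, X - Y, 0, 0) : Jet3) = ((0, X, 0, 0) : Jet3) - ((0, Y, 0, 0) : Jet3)) ∧
    (∀ (X Y : E3 [×2]→L[ℝ] E3), ((0, 0, X - Y, 0) : Jet3) = ((0, 0, X, 0) : Jet3) - ((0, 0, Y, 0) : Jet3)) ∧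
    (∀ (X Y : E3 [×3]→L[ℝ] E3), ((0, 0, 0, X - Y) : Jet3) = ((0, 0, 0, X) : Jet3) - ((0, 0, 0, Y) : Jet3)) := by
  refine ⟨fun X Y => ?_, fun X Y => ?_, fun X Y => ?_⟩ <;> ext <;> simp


/-- `(M eₐ, 0, 0, 0) = ∑_b M_{ba} • (e_b, 0, 0, 0)` for the Euclidean operator of a matrix. -/
theorem LU_expand (M : Matrix (Fin 3) (Fin 3) ℝ) (a : Fin 3) :
    ((Matrix.toEuclideanCLM (n := Fin 3) (𝕜 := ℝ) M (EuclideanSpace.single a (1 : ℝ)), 0, 0, 0) : Jet3) =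
      ∑ b : Fin 3, M b a • ((EuclideanSpace.single b (1 : ℝ), 0, 0, 0) : Jet3) := by
  rw [U_expand]
  simp only [KitSums.toEuclideanCLM_single]

/-- Re-ordering the three slots of a symmetric form along an explicit permutation. -/
theorem tri_perm {T : Jet3 [×3]→L[ℝ] ℝ} (hTsym : ∀ (x : Fin 3 → Jet3) (σ : Equiv.Perm (Fin 3)), T (x ∘ σ) = T x)
    (x : Fin 3 → Jet3) (σ : Equiv.Perm (Fin 3)) (y : Fin 3 → Jet3) (hy : x ∘ σ = y) : T y = T x := by
  rw [← hy, hTsym]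


/-- `f ∘ ![a] = ![f a]`. -/
theorem comp_vec1 {α : Type*} (f : Fin 3 → α) (a : Fin 3) : f ∘ ![a] = ![f a] := by
  funext s; fin_cases s; rfl

/-- `f ∘ ![a, b] = ![f a, f b]`. -/
theorem comp_vec2 {α : Type*} (f : Fin 3 → α) (a b : Fin 3) : f ∘ ![a, b] = ![f a, f b] := by
  funext s; fin_cases s <;> rfl

/-- `f ∘ ![a, b, c] = ![f a, f b, f c]`. -/
theorem comp_vec3 {α : Type*} (f : Fin 3 → α) (a b c : Fin 3) : f ∘ ![a, b, c] = ![f a, f b, f c] := by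
  funext s; fin_cases s <;> rfl


/-- `(fun s => e_{![a] s}) = ![e_a]`. -/
theorem vecE_fun1 (a : Fin 3) :
    (fun s : Fin 1 => EuclideanSpace.single ((![a] : Fin 1 → Fin 3) s) (1 : ℝ)) = ![EuclideanSpace.single a (1 : ℝ)] := by
  funext s; fin_cases s; rfl

/-- `(fun s => e_{![a, b] s}) = ![e_a, e_b]`. -/
theorem vecE_fun2 (a b : Fin 3) :
    (fun s : Fin 2 => EuclideanSpace.single ((![a, b] : Fin 2 → Fin 3) s) (1 : ℝ)) =
      ![EuclideanSpace.single a (1 : ℝ), EuclideanSpace.single b (1 : ℝ)] := by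
  funext s; fin_cases s <;> rfl

/-- `(fun s => e_{![a, b, c] s}) = ![e_a, e_b, e_c]`. -/
theorem vecE_fun3 (a b c : Fin 3) :
    (fun s : Fin 3 => EuclideanSpace.single ((![a, b, c] : Fin 3 → Fin 3) s) (1 : ℝ)) =
      ![EuclideanSpace.single a (1 : ℝ), EuclideanSpace.single b (1 : ℝ), EuclideanSpace.single c (1 : ℝ)] := by
  funext s; fin_cases s <;> rfl


/-! ### Folding raw coordinates into the coordinate functionals `jcU/jcA/jcH/jcT` -/

/-- `(z₀)_a = jcU a z`. -/
theorem coordU (z : Jet3) (a : Fin 3) : z.1 a = jcU a z := rfl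

/-- `(z₁ e_b)_a = jcA a b z`. -/
theorem coordA (z : Jet3) (a b : Fin 3) : z.2.1 (fun _ => EuclideanSpace.single b (1 : ℝ)) a = jcA a b z := rfl

/-- `(z₂ (e_b, e_c))_a = jcH a b c z`. -/
theorem coordH (z : Jet3) (a b c : Fin 3) :
    z.2.2.1 ![EuclideanSpace.single b (1 : ℝ), EuclideanSpace.single c (1 : ℝ)] a = jcH a b c z := rfl

/-- `(z₃ (e_b, e_c, e_d))_a = jcT a b c d z`. -/
theorem coordT (z : Jet3) (a b c d : Fin 3) :
    z.2.2.2 ![EuclideanSpace.single b (1 : ℝ), EuclideanSpace.single c (1 : ℝ), EuclideanSpace.single d (1 : ℝ)] a =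
      jcT a b c d z := rfl


/-- `(z₁ ![e_b])_a = jcA a b z` (vector-literal form of the argument). -/
theorem coordA1 (z : Jet3) (a b : Fin 3) : z.2.1 ![EuclideanSpace.single b (1 : ℝ)] a = jcA a b z := by
  have e : (![EuclideanSpace.single b (1 : ℝ)] : Fin 1 → E3) = fun _ => EuclideanSpace.single b (1 : ℝ) := by
    funext s; fin_cases s; rfl
  rw [e]; rfl


/-! ### Generic multilinear expansions ("shapes") used by the generated block files -/

/-- Shape `(u A H)`: first slot fixed, second and third slots expanded over coefficient families
(the function-type index innermost). -/
theorem shape_slot23 (hTsym : ∀ (x : Fin 3 → Jet3) (σ : Equiv.Perm (Fin 3)), T (x ∘ σ) = T x) (P : Jet3)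
    (A : Fin 3 → (Fin 1 → Fin 3) → ℝ) (XA : Fin 3 → (Fin 1 → Fin 3) → Jet3)
    (H : Fin 3 → (Fin 2 → Fin 3) → ℝ) (XH : Fin 3 → (Fin 2 → Fin 3) → Jet3) :
    T ![P, ∑ c : Fin 3, ∑ J : Fin 1 → Fin 3, A c J • XA c J, ∑ c : Fin 3, ∑ J : Fin 2 → Fin 3, H c J • XH c J] =
      ∑ c₁ : Fin 3, ∑ c₂ : Fin 3, ∑ J₁ : Fin 1 → Fin 3, ∑ J₂ : Fin 2 → Fin 3,
        A c₁ J₁ * (H c₂ J₂ * T ![P, XA c₁ J₁, XH c₂ J₂]) := by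
  simp only [(KitSums.tri_sum T _ _ _ _).2.1, (KitSums.tri_sum T _ _ _ _).2.2, CubicJetExpansion.tri_smul₂ hTsym,
    CubicJetExpansion.tri_smul₃ hTsym]
  refine Finset.sum_congr rfl fun c₁ _ => ?_
  rw [Finset.sum_comm]

/-- Shape `(u · ·)`: expansion of the first slot over a coefficient family. -/
theorem shape_slot1 (u : Fin 3 → ℝ) (U : Fin 3 → Jet3) (Q R : Jet3) :
    T ![∑ a : Fin 3, u a • U a, Q, R] = ∑ a : Fin 3, u a * T ![U a, Q, R] := by
  simp only [(KitSums.tri_sum T _ _ _ _).1, CubicJetExpansion.tri_smul₁]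

/-- Shape `(A A A)`: all three slots expanded over one family indexed by `Fin 9`. -/
theorem shape_cube (hTsym : ∀ (x : Fin 3 → Jet3) (σ : Equiv.Perm (Fin 3)), T (x ∘ σ) = T x)
    (V : Fin 9 → ℝ) (X : Fin 9 → Jet3) :
    T ![∑ p : Fin 9, V p • X p, ∑ p : Fin 9, V p • X p, ∑ p : Fin 9, V p • X p] =
      ∑ p : Fin 9, ∑ q : Fin 9, ∑ r : Fin 9, V p * V q * V r * T ![X p, X q, X r] := by
  simp only [(KitSums.tri_sum T _ _ _ _).1, (KitSums.tri_sum T _ _ _ _).2.1, (KitSums.tri_sum T _ _ _ _).2.2,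
    CubicJetExpansion.tri_smul₁, CubicJetExpansion.tri_smul₂ hTsym, CubicJetExpansion.tri_smul₃ hTsym]
  refine Finset.sum_congr rfl fun p _ => Finset.sum_congr rfl fun q _ => Finset.sum_congr rfl fun r _ => ?_
  ring


/-- A sum over `Fin 9`, written out (right-nested). -/
theorem sum_fin9 (f : Fin 9 → ℝ) :
    ∑ p : Fin 9, f p = f 0 + (f 1 + (f 2 + (f 3 + (f 4 + (f 5 + (f 6 + (f 7 + f 8))))))) := by
  simp only [Fin.sum_univ_succ, Fin.sum_univ_zero, Fin.isValue, add_zero]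
  rfl


/-! ### Registration hook (crux stmt-NavierStokesRegularity-1377, stub `stub_isoStructureThree`) -/

/-- **The weight-3 block decomposition** (hook form): for a smooth, pointwise cubic density of derivative weight 3,
`6 m z = 3 T(z_u,z_u,z_T) + 6 T(z_u,z_A,z_H) + T(z_A,z_A,z_A)` with `T = D³m(0)`. -/
theorem isoStructureThree_blocks : ∀ (m : Jet3 → ℝ), ContDiff ℝ (⊤ : ℕ∞) m → (∀ (μ : ℝ) (z : Jet3), m (μ • z) = μ ^ 3 * m z) → (∀ (s : ℝ), 0 < s → ∀ (z₀ : E3) (z₁ : E3 [×1]→L[ℝ] E3) (z₂ : E3 [×2]→L[ℝ] E3) (z₃ : E3 [×3]→L[ℝ] E3), m (z₀, s • z₁, (s ^ 2) • z₂, (s ^ 3) • z₃) = s ^ 3 * m (z₀, z₁, z₂, z₃)) → ∀ z : Jet3, 6 * m z = 3 * iteratedFDeriv ℝ 3 m 0 ![((z.1, 0, 0, 0) : Jet3), ((z.1, 0, 0, 0) : Jet3), ((0, 0, 0, z.2.2.2) : Jet3)] + 6 * iteratedFDeriv ℝ 3 m 0 ![((z.1, 0, 0, 0) : Jet3), ((0,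 z.2.1, 0, 0) : Jet3), ((0, 0, z.2.2.1, 0) : Jet3)] + iteratedFDeriv ℝ 3 m 0 ![((0, z.2.1, 0, 0) : Jet3), ((0, z.2.1, 0, 0) : Jet3), ((0, z.2.1, 0, 0) : Jet3)] :=
  fun _ hm hcub hwt z => six_m_eq_blocks hm hcub hwt z

end IsoStructureThree

end Summit.NavierStokesRegularity.NavierStokesRegularity.Theorems

end
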